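import Literature.Analysis.FluidPDE.HardSphereFlowOrbits
import Literature.Analysis.FluidPDE.HardSphereFlowMeasurable
import Literature.Analysis.FluidPDE.HardSphereFlowRegular
import Literature.Analysis.FluidPDE.HardSphereTorusMeasure
import HarnessLib

/-!
# The single-collision event of a time window of the hard-sphere flow
(Cercignani–Illner–Pulvirenti 1994 App. 4.A–4.B; Gallagher–Saint-Raymond–Texier 2013 Prop. 4.1.1,
Lemma 4.1.2; trunk T-KINETIC, topic Analysis/FluidPDE; steps C1–C2 of the plan for the one-step
mild BBGKY hierarchy almost everywhere, input (H1) of `hs_seriesFamily_ae_eq_of_oneStep`.)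

In the derivation of the BBGKY hierarchy from the Liouville dynamics, the change of the
`s`-marginal over a short time window `(0, δ]` is computed on the data whose orbit has EXACTLY
ONE collision instant in the window, and bounded on the rest. This file describes that event in
terms of the explicit functionals of the collision-by-collision construction of the flow
(`Alexander.collisionInstant`, `Alexander.freeExitTime`, `HardSphereFlowConstruction`;
`HardSphereFlowOrbits` for the structure of forward-good orbits):

* `Alexander.singleCollisionEvent G ε a b δ` — the set of good data `z` with
  `t₁(z) ≤ δ < t₂(z)` whose first exit configuration `S_{t₁} z` has the pair `(a, b)` in contact;
  it is measurable (`measurableSet_singleCollisionEvent`, regular measurable geometry);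
* the structure of the flow on this event (`singleCollisionEvent_structure`): `0 < t₁ ≤ δ`, the
  exit configuration `w_in = S_{t₁} z` is a simple incoming collision configuration of the pair
  `(a, b)`, the flow is the free flight on `[0, t₁)`, and
  `Φ_δ z = S_{δ - t₁} (collidePair a b w_in)`; moreover no pair is in contact at the times of
  `(0, t₁)` and of `(t₁, δ]` (`singleCollisionEvent_not_mem_contactSet`).

## References

* C. Cercignani, R. Illner, M. Pulvirenti, *The Mathematical Theory of Dilute Gases*, Springer
  (1994), App. 4.A pp. 107–111, App. 4.B.
* I. Gallagher, L. Saint-Raymond, B. Texier, *From Newton to Boltzmann*, EMS (2013),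
  arXiv:1208.5753, Prop. 4.1.1, Lemma 4.1.2.
-/

open MeasureTheory Set Filter Topology Function
open scoped ENNReal

namespace Literature.Analysis.FluidPDE

noncomputable section

section Kinetic

variable {d : Type*} [Fintype d] {X : Type*} {N : ℕ}

namespace Alexander

variable (G : Geometry d X) (ε : ℝ)

/-- **The single-collision event of the window `(0, δ]` with colliding pair `(a, b)`**: good
data `z` with first collision instant `t₁(z) ≤ δ`, second instant `t₂(z) > δ`, and the pair
`(a, b)` in contact in the first exit configuration `S_{t₁(z)} z`. [folklore] -/
def singleCollisionEvent (a b : Fin N) (δ : ℝ) : Set (Config N d X) :=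
  {z | z ∈ good G ε ∧ collisionInstant G ε z 1 ≤ ENNReal.ofReal δ ∧ ENNReal.ofReal δ < collisionInstant G ε z 2 ∧
    freeFlight G (collisionInstant G ε z 1).toReal z ∈ contactSet G N ε a b}

variable {G ε}

/-- Membership in the single-collision event. [folklore] -/
theorem mem_singleCollisionEvent {a b : Fin N} {δ : ℝ} {z : Config N d X} :
    z ∈ singleCollisionEvent G ε a b δ ↔ z ∈ good G ε ∧ collisionInstant G ε z 1 ≤ ENNReal.ofReal δ ∧
      ENNReal.ofReal δ < collisionInstant G ε z 2 ∧
      freeFlight G (collisionInstant G ε z 1).toReal z ∈ contactSet G N ε a b :=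
  Iff.rfl

section Measurable

variable [MeasurableSpace X] [TopologicalSpace X]

/-- The single-collision event is measurable (regular measurable geometry with measurable good
set). [folklore] -/
theorem measurableSet_singleCollisionEvent (hG : G.IsHardSphereRegular ε) (hGm : G.IsMeasurable)
    (hgood : MeasurableSet (good G ε : Set (Config N d X))) (a b : Fin N) (δ : ℝ) :
    MeasurableSet (singleCollisionEvent G ε a b δ : Set (Config N d X)) := by
  have h1 : Measurable fun z : Config N d X => collisionInstant G ε z 1 := measurable_collisionInstant hG hGm 1
  have h2 : Measurable fun z : Config N d X => collisionInstant G ε z 2 := measurable_collisionInstant hG hGm 2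
  have hff : Measurable fun z : Config N d X => freeFlight G (collisionInstant G ε z 1).toReal z :=
    hGm.measurable_freeFlight₂.comp (h1.ennreal_toReal.prodMk measurable_id)
  have hc : MeasurableSet (contactSet G N ε a b : Set (Config N d X)) := measurableSet_contactSet G hGm.measurable_sepVec N ε a b
  unfold singleCollisionEvent
  rw [setOf_and, setOf_and, setOf_and]
  exact hgood.inter ((measurableSet_le h1 measurable_const).inter ((measurableSet_lt measurable_const h2).inter (hc.preimage hff)))

end Measurable

section Structure

variable [TopologicalSpace X] {a b : Fin N} {δ : ℝ} {z : Config N d X}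

/-- **The structure of the flow on the single-collision event.** For `z` in the event with
`t₁ = t₁(z)`: `0 < t₁ ≤ δ`; the first exit configuration `w_in = S_{t₁} z` is a simple incoming
collision configuration of a pair `p` with `{p.1, p.2} = {a, b}`; the flow is the free flight on
`[0, t₁)`; and `Φ_δ z = S_{δ - t₁} (collidePair a b w_in)` (regular geometry). [folklore] -/
theorem singleCollisionEvent_structure (hG : G.IsHardSphereRegular ε) (hab : a ≠ b)
    (hz : z ∈ singleCollisionEvent G ε a b δ) :
    0 < (collisionInstant G ε z 1).toReal ∧ (collisionInstant G ε z 1).toReal ≤ δ ∧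
    (∃ p : Fin N × Fin N, IsSimpleIncomingWith G ε (freeFlight G (collisionInstant G ε z 1).toReal z) p ∧
      ({p.1, p.2} : Finset (Fin N)) = {a, b}) ∧
    (∀ u : ℝ, 0 ≤ u → u < (collisionInstant G ε z 1).toReal → flow G ε u z = freeFlight G u z) ∧
    flow G ε δ z = freeFlight G (δ - (collisionInstant G ε z 1).toReal)
      (collidePair G a b (freeFlight G (collisionInstant G ε z 1).toReal z)) := by
  obtain ⟨hzg, h1, h2, hc⟩ := hz
  have hτ1 : collisionInstant G ε z 1 = freeExitTime G ε z := collisionInstant_one z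
  -- finiteness and positivity of `t₁`
  have hfin : collisionInstant G ε z 1 ≠ ∞ := ne_top_of_le_ne_top ENNReal.ofReal_ne_top h1
  have hpos : 0 < freeExitTime G ε z := freeExitTime_pos_of_mem_good hG hzg
  have hδ0 : 0 ≤ δ := by
    by_contra hδ
    rw [ENNReal.ofReal_of_nonpos (not_le.1 hδ).le, nonpos_iff_eq_zero, hτ1] at h1
    exact hpos.ne' h1
  have hτpos : 0 < (collisionInstant G ε z 1).toReal := by
    rw [hτ1]; exact ENNReal.toReal_pos (by rw [← hτ1] at hpos ⊢; exact hpos.ne') (by rwa [← hτ1])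
  have hτle : (collisionInstant G ε z 1).toReal ≤ δ := by
    have := ENNReal.toReal_mono ENNReal.ofReal_ne_top h1
    rwa [ENNReal.toReal_ofReal hδ0] at this
  -- the simple incoming exit configuration
  have hfinτ : freeExitTime G ε (stateAfter G ε z 0) ≠ ∞ := by rwa [stateAfter_zero, ← hτ1]
  obtain ⟨p, hp, hstate⟩ := hzg.2.2.1.exists_stateAfter_succ hfinτ
  rw [stateAfter_zero, ← hτ1] at hp hstate
  have hpab : ({p.1, p.2} : Finset (Fin N)) = {a, b} := by
    rcases hp.eq_or_eq_of_mem_contactSet hab hc with ⟨rfl, rfl⟩ | ⟨rfl, rfl⟩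
    · rfl
    · exact Finset.pair_comm _ _
  refine ⟨hτpos, hτle, ⟨p, hp, hpab⟩, fun u hu0 hu => ?_, ?_⟩
  · -- free flight before `t₁`
    rw [flow_of_nonneg hu0, fwdFlow_eq_of_segment (k := 0) (by simp) ?_, collisionInstant_zero, ENNReal.toReal_zero,
      sub_zero, stateAfter_zero]
    rw [zero_add]
    calc ENNReal.ofReal u < ENNReal.ofReal (collisionInstant G ε z 1).toReal := (ENNReal.ofReal_lt_ofReal_iff hτpos).2 hu
      _ = collisionInstant G ε z 1 := ENNReal.ofReal_toReal hfin
  · -- after the collision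
    rw [flow_of_nonneg hδ0, fwdFlow_eq_of_segment (k := 1) h1 h2]
    congr 1
    rw [zero_add] at hstate
    rw [hstate]
    -- `collidePair p.1 p.2 = collidePair a b` at the contact configuration
    have hcon : ‖G.sepVec ((freeFlight G (collisionInstant G ε z 1).toReal z) a).1
        ((freeFlight G (collisionInstant G ε z 1).toReal z) b).1‖ ≤ ε := le_of_eq hc.2
    rcases hp.eq_or_eq_of_mem_contactSet hab hc with ⟨h1', h2'⟩ | ⟨h1', h2'⟩
    · rw [← h1', ← h2']
    · rw [← h1', ← h2', hG.collidePair_comm hab hcon]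


/-- **No contact strictly inside the window, off the collision instant**: for `z` in the
single-collision event, no pair is in contact along the free flight on `(0, t₁)`, nor along the
free flight of the post-collisional configuration on `(0, δ - t₁]` (no grazing touch on a
forward-good orbit, and `t₂ > δ`). [folklore] -/
theorem singleCollisionEvent_not_mem_contactSet (hG : G.IsHardSphereRegular ε) (hab : a ≠ b)
    (hz : z ∈ singleCollisionEvent G ε a b δ) :
    (∀ u : ℝ, 0 < u → u < (collisionInstant G ε z 1).toReal → ∀ i j : Fin N, i ≠ j →
      freeFlight G u z ∉ contactSet G N ε i j) ∧
    (∀ u : ℝ, 0 < u → u ≤ δ - (collisionInstant G ε z 1).toReal → ∀ i j : Fin N, i ≠ j →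
      freeFlight G u (collidePair G a b (freeFlight G (collisionInstant G ε z 1).toReal z)) ∉ contactSet G N ε i j) := by
  obtain ⟨hτpos, hτle, ⟨p, hp, hpab⟩, -, -⟩ := singleCollisionEvent_structure hG hab hz
  obtain ⟨hzg, h1, h2, hc⟩ := hz
  have hτ1 : collisionInstant G ε z 1 = freeExitTime G ε z := collisionInstant_one z
  have hfin : collisionInstant G ε z 1 ≠ ∞ := ne_top_of_le_ne_top ENNReal.ofReal_ne_top h1
  have hgood := hzg.2.2.1
  constructor
  · intro u hu0 hu i j hij
    have h := hgood.2.1 0 u hu0 ?_ i j hij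
    · simpa [stateAfter_zero] using h
    · rw [stateAfter_zero, ← hτ1, ← ENNReal.ofReal_toReal hfin]
      exact (ENNReal.ofReal_lt_ofReal_iff hτpos).2 hu
  · intro u hu0 hu i j hij
    -- the post-collisional configuration is the state after the first collision
    have hfinτ : freeExitTime G ε (stateAfter G ε z 0) ≠ ∞ := by rwa [stateAfter_zero, ← hτ1]
    obtain ⟨p', hp', hstate⟩ := hgood.exists_stateAfter_succ hfinτ
    rw [stateAfter_zero, ← hτ1] at hp' hstate
    rw [zero_add] at hstate
    have hcon : ‖G.sepVec ((freeFlight G (collisionInstant G ε z 1).toReal z) a).1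
        ((freeFlight G (collisionInstant G ε z 1).toReal z) b).1‖ ≤ ε := le_of_eq hc.2
    have hcp : collidePair G a b (freeFlight G (collisionInstant G ε z 1).toReal z) = stateAfter G ε z 1 := by
      rw [hstate]
      rcases hp'.eq_or_eq_of_mem_contactSet hab hc with ⟨h1', h2'⟩ | ⟨h1', h2'⟩
      · rw [← h1', ← h2']
      · rw [← h1', ← h2', hG.collidePair_comm hab hcon]
    rw [hcp]
    refine hgood.2.1 1 u hu0 ?_ i j hij
    -- `u ≤ δ - t₁ < t₂ - t₁ = τ(z_1)`
    have h2' : ENNReal.ofReal δ < collisionInstant G ε z 1 + freeExitTime G ε (stateAfter G ε z 1) := by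
      rw [← collisionInstant_succ]; exact h2
    have hδ0 : 0 ≤ δ := hτpos.le.trans hτle
    calc ENNReal.ofReal u ≤ ENNReal.ofReal (δ - (collisionInstant G ε z 1).toReal) := ENNReal.ofReal_le_ofReal hu
      _ < freeExitTime G ε (stateAfter G ε z 1) := ofReal_sub_toReal_lt hδ0 h1 h2'

/-- **The collision instant of a datum of the event whose free flight meets an incoming contact
of the pair at time `τ`** is `τ`: the exit time is at most `τ` (an incoming contact pair leaves
the domain at once), and the pair `(a, b)` is not in contact before `τ` by hypothesis, while it
is at the first instant. [folklore] -/
theorem toReal_collisionInstant_one_eq (hG : G.IsHardSphereRegular ε) {τ : ℝ} (hτ0 : 0 < τ)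
    (hz : z ∈ singleCollisionEvent G ε a b δ)
    {p : Fin N × Fin N} (hp : IsSimpleIncomingWith G ε (freeFlight G τ z) p)
    (hbefore : ∀ u : ℝ, 0 ≤ u → u < τ → freeFlight G u z ∉ contactSet G N ε a b) :
    (collisionInstant G ε z 1).toReal = τ := by
  obtain ⟨hzg, h1, h2, hc⟩ := hz
  have hτ1 : collisionInstant G ε z 1 = freeExitTime G ε z := collisionInstant_one z
  have hfin : collisionInstant G ε z 1 ≠ ∞ := ne_top_of_le_ne_top ENNReal.ofReal_ne_top h1
  -- the exit time is at most `τ`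
  have hle : freeExitTime G ε z ≤ ENNReal.ofReal τ := by
    refine freeExitTime_le_of_frequently hτ0.le ?_
    have hev := hG.eventually_freeFlight_not_mem hp.ne hp.mem_contactSet hp.isIncoming
    have hmap : Tendsto (fun t : ℝ => t - τ) (𝓝[>] τ) (𝓝[>] 0) := by
      have ht : Tendsto (fun t : ℝ => t - τ) (𝓝 τ) (𝓝 0) := by
        have := (continuous_sub_right τ).tendsto τ
        rwa [sub_self] at this
      refine tendsto_nhdsWithin_of_tendsto_nhds_of_eventually_within _ (ht.mono_left nhdsWithin_le_nhds) ?_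
      filter_upwards [self_mem_nhdsWithin] with t ht'
      exact sub_pos.2 (mem_Ioi.1 ht')
    have hev' : ∀ᶠ t : ℝ in 𝓝[>] τ, freeFlight G t z ∉ hardSphereDomain G N ε := by
      filter_upwards [hmap.eventually hev] with t ht'
      rwa [← freeFlight_add, sub_add_cancel] at ht'
    exact hev'.frequently
  have hleR : (collisionInstant G ε z 1).toReal ≤ τ := by
    have := ENNReal.toReal_mono ENNReal.ofReal_ne_top (hτ1 ▸ hle)
    rwa [ENNReal.toReal_ofReal hτ0.le] at this
  -- and not smaller
  refine le_antisymm hleR (not_lt.1 fun hlt => ?_)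
  exact hbefore _ ENNReal.toReal_nonneg hlt hc

end Structure

end Alexander

section TorusSeparation

open scoped InnerProductSpace

/-- **Quantitative separation after an outgoing contact on `T^d`**: if `‖sep(x_i, x_j)‖ = ε < 1/2`,
`⟪sep, v_i - v_j⟫ > 0` and `0 < u` with `u ‖v_i - v_j‖ < 1/2 - ε` (the flight stays in the
chart), then the freely flown pair is at distance `> ε`
(`‖sep + u(v_i - v_j)‖² = ε² + 2u⟪sep, v_i - v_j⟫ + u²‖v_i - v_j‖² > ε²`). [folklore] -/
theorem norm_sepVec_freeFlight_gt_of_outgoing {ε : ℝ} {N : ℕ} (W : Config N d (UnitAddTorus d))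
    {i j : Fin N} (hdist : ‖(Torus.geometry d).sepVec (W i).1 (W j).1‖ = ε)
    (hout : 0 < ⟪(Torus.geometry d).sepVec (W i).1 (W j).1, (W i).2 - (W j).2⟫_ℝ)
    {u : ℝ} (hu0 : 0 < u) (hu : u * ‖(W i).2 - (W j).2‖ < 2⁻¹ - ε) :
    ε < ‖(Torus.geometry d).sepVec (freeFlight (Torus.geometry d) u W i).1 (freeFlight (Torus.geometry d) u W j).1‖ := by
  set Δ : EuclideanSpace ℝ d := (W i).2 - (W j).2 with hΔ
  set σ₀ : EuclideanSpace ℝ d := (Torus.geometry d).sepVec (W i).1 (W j).1 with hσ₀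
  have hchart : ‖σ₀‖ + ‖u • (W i).2 - u • (W j).2‖ < 1 / 2 := by
    rw [← smul_sub, norm_smul, Real.norm_of_nonneg hu0.le, hσ₀, hdist]
    linarith
  have hsep : (Torus.geometry d).sepVec (freeFlight (Torus.geometry d) u W i).1 (freeFlight (Torus.geometry d) u W j).1 =
      σ₀ + u • Δ := by
    simp only [freeFlight_apply]
    rw [Torus.sepVec_translate_of_norm_lt hchart, ← smul_sub]
  rw [hsep]
  have hsq : ‖σ₀ + u • Δ‖ ^ 2 = ε ^ 2 + 2 * u * ⟪σ₀, Δ⟫_ℝ + u ^ 2 * ‖Δ‖ ^ 2 := by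
    rw [norm_add_sq_real, norm_smul, real_inner_smul_right, Real.norm_of_nonneg hu0.le, hσ₀, hdist]
    ring
  have hε0 : 0 ≤ ε := hdist ▸ norm_nonneg _
  have hgt : ε ^ 2 < ‖σ₀ + u • Δ‖ ^ 2 := by
    rw [hsq]
    have : 0 < 2 * u * ⟪σ₀, Δ⟫_ℝ := by positivity
    nlinarith [sq_nonneg (u * ‖Δ‖)]
  exact lt_of_pow_lt_pow_left₀ 2 (norm_nonneg _) hgt

/-- **Quantitative separation BEFORE an incoming contact on `T^d`**: if `‖sep(x_i, x_j)‖ = ε < 1/2`,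
`⟪sep, v_i - v_j⟫ < 0` (incoming) and `0 < u` with `u ‖v_i - v_j‖ < 1/2 - ε`, then the pair flown
freely BACKWARDS for the time `u` is at distance `> ε` (velocity flip of
`norm_sepVec_freeFlight_gt_of_outgoing`). [folklore] -/
theorem norm_sepVec_freeFlight_neg_gt_of_incoming {ε : ℝ} {N : ℕ} (W : Config N d (UnitAddTorus d))
    {i j : Fin N} (hdist : ‖(Torus.geometry d).sepVec (W i).1 (W j).1‖ = ε)
    (hin : ⟪(Torus.geometry d).sepVec (W i).1 (W j).1, (W i).2 - (W j).2⟫_ℝ < 0)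
    {u : ℝ} (hu0 : 0 < u) (hu : u * ‖(W i).2 - (W j).2‖ < 2⁻¹ - ε) :
    ε < ‖(Torus.geometry d).sepVec (freeFlight (Torus.geometry d) (-u) W i).1 (freeFlight (Torus.geometry d) (-u) W j).1‖ := by
  have hflip := Alexander.flipVel_freeFlight_flipVel (Torus.geometry d) u W
  rw [← hflip]
  simp only [flipVel_apply]
  have hdist' : ‖(Torus.geometry d).sepVec ((flipVel W) i).1 ((flipVel W) j).1‖ = ε := by simpa [flipVel_apply] using hdist
  have hout' : 0 < ⟪(Torus.geometry d).sepVec ((flipVel W) i).1 ((flipVel W) j).1, (flipVel W i).2 - (flipVel W j).2⟫_ℝ := by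
    simp only [flipVel_apply]
    rw [show -(W i).2 - -(W j).2 = -((W i).2 - (W j).2) by abel, inner_neg_right]
    linarith
  have hu' : u * ‖(flipVel W i).2 - (flipVel W j).2‖ < 2⁻¹ - ε := by
    simp only [flipVel_apply]
    rwa [show -(W i).2 - -(W j).2 = -((W i).2 - (W j).2) by abel, norm_neg]
  exact norm_sepVec_freeFlight_gt_of_outgoing (flipVel W) hdist' hout' hu0 hu'

end TorusSeparation


end Kinetic

end

end Literature.Analysis.FluidPDE
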